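import Literature.AnabelianGeometry.AbsoluteAnabelian.AbsTopII.EllipticCuspidalizationComparison
import HarnessLib

/-!
# [AbsTopII] Cor 3.3 (ii), (iii) over `(𝒟, M)`: the universal closures over models of the schemata
# `EllipticModel.Cor_3_3_ii` / `EllipticModel.Cor_3_3_iii` hold IFF they are vacuous (kernel)
# — FACT-LIST rows F-0290, F-0291

S. Mochizuki, *Topics in Absolute Anabelian Geometry II: Decomposition Groups and Endomorphisms*
[AbsTopII], Corollary 3.3 (ii) p. 68, (iii) pp. 68–69 (manuscript pagination, lit key
`paper:url-585b8d0ad0d9`; bib key `MochizukiAbsTopII2013`).  PROOF-ONLY companion of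
`AbsTopII/EllipticCuspidalizationComparison.lean` (abc-iut-L4, p409138), which types Cor 3.3
(i)(ii)(iii) in their printed generality as SCHEMATA `EllipticModel.Cor_3_3_i/ii/iii` over a class
`𝒟 : ConstructionDataClass` AND a model `M : EllipticModel 𝒟` of the §3 scheme-side data (shape (M):
"MODEL INTERFACE; no instance in the tree").

abc-iut cell, FACT-LIST rows **F-0290** (`EllipticModel.Cor_3_3_ii`) and **F-0291**
(`EllipticModel.Cor_3_3_iii`), `kernel_closedness = parametrised`; plan rule R1/R5 (abc-iut-plan
05:41:23Z).  VERDICT ON THE UNIVERSAL CLOSURE (over models `M`, for any fixed class `𝒟`), PROVED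
here: it holds **if and only if it is vacuous** —
* `EllipticModel.forall_cor_3_3_ii_iff_vacuous`: `(∀ M, M.Cor_3_3_ii)` iff, under the
  `𝒟`-hypotheses, NO model has a member satisfying the standing hypotheses of Cor 3.3
  (`IsCor33Member`: `([X],[k],Σ) ∈ 𝒟`, `X` `Π`-elliptically admissible, `G` slim, some `χ_l` open,
  `Δ` slim and `≠ 1`).  Mechanism: `doubleCovers` ("the open subgroups `Π_D ⊆ Π_C` that arise from
  double coverings exhibiting `C` as semi-elliptic") is FREE model data; replacing it by `Set.univ`
  keeps every axiom of `EllipticModel` and every standing hypothesis, while `⊤ ∈ Set.univ` has index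
  `1 ≠ 2`, so it is not in the REAL right-hand side `semiEllipticDoubleCoverSubgroups`.
* `EllipticModel.forall_cor_3_3_iii_iff_vacuous`: `(∀ M, M.Cor_3_3_iii)` iff, under the
  `𝒟`-hypotheses, no model has such a member together with a `Setting` (the running data
  `(D → C, G', N, U, V, U_X)` of Cor 3.3 (iii)).  Mechanism: from one setting `s₀` build the model
  whose settings are the pairs `(s, G')`, `G'` any open normal subgroup of `G`, with `Π_D := Π_C`
  (`PiD := ⊤`, again free data, `doubleCovers := univ`); "for `G'` sufficiently small" is met by an
  open normal `G' ⊆ G₀` (profinite `G`), and a matching `EllipticCuspidalization` would carry its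
  index-`2` subgroup `Π_D` isomorphically onto `⊤` (index `1`).
So neither row is a closed fact: each is a SCHEMA, to be consumed BY NAME at the intended
(étale-`π₁`) model — exactly as the trunk file's docstring says; an outright kernel refutation
`¬ ∀ 𝒟 M, …` would require INHABITING `IsCor33Member` (a slim nontrivial profinite `Δ` and a field
with open `l`-adic cyclotomic image), which the tree does not construct.  CONSUMER CENSUS (R5):
`EllipticModel.Cor_3_3_ii` is consumed only by `image_doubleCovers_eq_of_cor_3_3_ii` /
`map_PiD_mem_doubleCovers_of_cor_3_3_ii` (`AbsTopII/SemiEllipticTransport.lean`), generic in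
`(𝒟, M)`; `EllipticModel.Cor_3_3_iii` only by the PROVED reduction `cor_3_3_iii_of_ex_4_8_i` in the
trunk file, generic in `M`; no named `EllipticModel` instance exists in the tree.

HONEST FRAMING: elementary bookkeeping about the abstract schemata; says nothing about hyperbolic
orbicurves, nothing about the published theorem [AbsTopII] Cor 3.3, nothing about [IUTchIII]
Cor 3.12; no side taken; typed ≠ proved for the geometric instance.
-/

noncomputable section

open CategoryTheory Topology

universe u

namespace Literature.AnabelianGeometry.AbsoluteAnabelian.AbsTopII

open FundamentalExtension
open AbsTopI (ConstructionDataClass)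

variable {𝒟 : ConstructionDataClass.{u}}

namespace EllipticModel

/-- **FACT-LIST F-0290 — the universal closure over models of the schema `EllipticModel.Cor_3_3_ii`
holds iff it is vacuous**: `∀ M : EllipticModel 𝒟, M.Cor_3_3_ii` is equivalent to "under the
`𝒟`-hypotheses no model has a member satisfying the standing hypotheses of Cor 3.3".  (`→`: the
model with `doubleCovers := Set.univ` has the same members, and `⊤` has index `1 ≠ 2`; `←`:
vacuity.)  The row is a schema consumed by name, not a closed fact.
[cite: MochizukiAbsTopII2013, Cor 3.3 (ii) p.68] -/
theorem forall_cor_3_3_ii_iff_vacuous :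
    (∀ M : EllipticModel 𝒟, M.Cor_3_3_ii) ↔
      (𝒟.IsChainFull → 𝒟.RelIsomDGC →
        ∀ (M : EllipticModel 𝒟) (b : 𝒟.Base) (X : (𝒟.datum b).Obj), ¬ M.IsCor33Member b X) := by
  constructor
  · intro H hfull hGC M b X hX
    -- the model with ALL subgroups declared "double coverings exhibiting `C` as semi-elliptic"
    let M' : EllipticModel 𝒟 :=
      { M with
        doubleCovers := fun _ _ => Set.univ
        PiD_mem := fun _ => Set.mem_univ _ }
    have hX' : M'.IsCor33Member b X :=
      ⟨hX.mem, hX.ellipticallyAdmissible, hX.slim, hX.cyclotomic, hX.geom_slim, hX.geom_ne_bot⟩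
    have h : M'.doubleCovers b X = semiEllipticDoubleCoverSubgroups (M.coreExt b X) :=
      H M' hfull hGC b X hX'
    have htop : (⊤ : Subgroup (M.coreExt b X).arith) ∈
        semiEllipticDoubleCoverSubgroups (M.coreExt b X) := by
      rw [← h]
      exact Set.mem_univ _
    obtain ⟨-, hidx, -⟩ := htop
    rw [Subgroup.index_top] at hidx
    exact absurd hidx (by norm_num)
  · intro hvac M hfull hGC b X hX
    exact absurd hX (hvac hfull hGC M b X)

/-- The `Π`-component of an isomorphism of extensions is bijective. [folklore] -/
private theorem arith_bijective_of_iso {E F : FundamentalExtension.{u}} (e : E ≅ F) :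
    Function.Bijective e.hom.arith := by
  have h₁ : ∀ x, e.inv.arith (e.hom.arith x) = x := fun x =>
    congrArg (fun f : E ⟶ E => f.arith x) e.hom_inv_id
  have h₂ : ∀ y, e.hom.arith (e.inv.arith y) = y := fun y =>
    congrArg (fun f : F ⟶ F => f.arith y) e.inv_hom_id
  exact ⟨fun x y hxy => by rw [← h₁ x, ← h₁ y, hxy], fun y => ⟨e.inv.arith y, h₂ y⟩⟩

/-- **FACT-LIST F-0291 — the universal closure over models of the schema `EllipticModel.Cor_3_3_iii`
holds iff it is vacuous**: `∀ M : EllipticModel 𝒟, M.Cor_3_3_iii` is equivalent to "under the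
`𝒟`-hypotheses no model has a member satisfying the standing hypotheses of Cor 3.3 together with a
setting `(D → C, G', N, U, V, U_X)`".  (`→`: from a setting `s₀` build the model whose settings are
the pairs `(s, G')`, `G' ⊆ G` open normal, with `Π_D := Π_C`; for the open `G₀` produced by the
statement pick an open normal `G' ⊆ G₀`; a matching `EllipticCuspidalization` maps its index-`2`
subgroup `Π_D` isomorphically onto `⊤`, index `1` — contradiction; `←`: vacuity, with `G₀ := G`.)
The row is a schema consumed by name, not a closed fact.
[cite: MochizukiAbsTopII2013, Cor 3.3 (iii) pp.68-69] -/
theorem forall_cor_3_3_iii_iff_vacuous :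
    (∀ M : EllipticModel 𝒟, M.Cor_3_3_iii) ↔
      (𝒟.IsChainFull → 𝒟.RelIsomDGC →
        ∀ (M : EllipticModel 𝒟) (b : 𝒟.Base) (X : (𝒟.datum b).Obj),
          M.IsCor33Member b X → IsEmpty (M.Setting b X)) := by
  constructor
  · intro H hfull hGC M b X hX
    by_contra hne
    rw [not_isEmpty_iff] at hne
    obtain ⟨s₀⟩ := hne
    -- the model whose settings are pairs `(s, G')`, `G'` open normal in `G`, with `Π_D := Π_C`
    let M' : EllipticModel 𝒟 :=
      { M with
        doubleCovers := fun _ _ => Set.univ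
        Setting := fun b X => M.Setting b X × OpenNormalSubgroup ((𝒟.datum b).ext X).gal
        PiD := fun _ => ⊤
        PiD_mem := fun _ => Set.mem_univ _
        galOpen := fun {b X} s => (s.2.toOpenSubgroup : Subgroup ((𝒟.datum b).ext X).gal)
        normal_galOpen := fun s => s.2.isNormal'
        isOpen_galOpen := fun s => s.2.toOpenSubgroup.isOpen
        level := fun s => M.level s.1
        level_isSigmaInteger := fun s => M.level_isSigmaInteger s.1
        PiV := fun {b X} s =>
          M.PiV s.1 ⊓ (s.2.toOpenSubgroup : Subgroup ((𝒟.datum b).ext X).gal).comap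
            ((𝒟.datum b).ext X).aug.toMonoidHom
        normal_PiV := fun s => by
          haveI := M.normal_PiV s.1
          haveI := s.2.isNormal'
          exact Subgroup.normal_inf_normal _ _
        isOpen_PiV := fun {b X} s => by
          have h := (M.isOpen_PiV s.1).inter
            (IsOpen.preimage (map_continuous ((𝒟.datum b).ext X).aug) s.2.toOpenSubgroup.isOpen)
          exact h
        PiV_le := fun _ => inf_le_right
        map_PiV_le := fun _ => le_top
        cuspUX := fun s => M.cuspUX s.1
        proSet_geom_cuspUX := fun s => M.proSet_geom_cuspUX s.1
        cuspsUX := fun s => M.cuspsUX s.1 }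
    have hX' : M'.IsCor33Member b X :=
      ⟨hX.mem, hX.ellipticallyAdmissible, hX.slim, hX.cyclotomic, hX.geom_slim, hX.geom_ne_bot⟩
    obtain ⟨G₀, hG₀, hall⟩ := H M' hfull hGC b X hX' (M.level s₀)
    -- "for `G'` sufficiently small": an open normal `G' ⊆ G₀`
    obtain ⟨G', hG'⟩ :=
      ProfiniteGrp.exist_openNormalSubgroup_sub_open_nhds_of_one hG₀ G₀.one_mem
    obtain ⟨C, hmatch, -⟩ := hall (s₀, G') rfl (fun g hg => hG' hg)
    obtain ⟨-, -, ⟨e, -, hPiD⟩, -⟩ := hmatch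
    -- `Π_D ⊆ Π_C` of the matching cuspidalization has index `2`, its image `⊤` has index `1`
    have h2 : (M'.PiD (s₀, G')).index = 2 := by
      rw [← hPiD, Subgroup.index_map_of_bijective (arith_bijective_of_iso e)]
      exact C.index_PiD
    have h1 : (M'.PiD (s₀, G')).index = 1 := Subgroup.index_top
    omega
  · intro hvac M hfull hGC b X hX N
    haveI := hvac hfull hGC M b X hX
    exact ⟨⊤, isOpen_univ, fun s => isEmptyElim s⟩

end EllipticModel

end Literature.AnabelianGeometry.AbsoluteAnabelian.AbsTopII
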